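import Summits.AtomisticToContinuum.Crystallization.Theorems.PricedLinkCensusStackingHingeRootSlpGood
import Summits.AtomisticToContinuum.Crystallization.Theorems.PricedLinkCensusStackingHingeBondShellTransfer
import Summits.AtomisticToContinuum.Crystallization.Theorems.PricedLinkCensusStackingHingeSecondShellGap
import Mathlib

/-!
# `PricedLinkCensus.StackingHinge` (stmt-AtomisticToContinuum-14993), line `Sketch`,
# stub `stub_rootBondShellGood`: the root of the Benjamini–Schramm limit law is bond-shell-good a.s.

Let `P` be the Benjamini–Schramm limit (item 9230) of a Lennard-Jones ground-state sequence `x`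
along `φ`, with its hard-core clause (`P`-a.e. `μ = count|S`, `0 ∈ S`, `S` `δ`-separated) and its
DENSITY-TRANSFER clause (finite-`N` densities of `(R, ε)`-windows are bounded BELOW by
`P`-probabilities).  Granted `SoftLayerPropagation` and the inlined `ChargeFreeWindows`, the root `0`
of `P`-a.e. configuration `count|S` is BOND-SHELL-GOOD: with `nn = infDist 0 (S ∖ {0})`, no point of
`S ∖ {0}` lies at distance in `(1.01 nn, 1.07 nn)` from `0`, and twelve points of `S ∖ {0}` lie within
`1.01 nn` of `0` (the closed, limit-stable shadow of `IsChargeFree (1/100)`).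

Proof (contraposition on bad sets, exactly as for `stub_rootSlpGoodOfTransfer`).  For rational
`θ ∈ (0, 1/100]` let `T θ = {count|S : 0 ∈ S, S δ-separated, S not θ-good}`, θ-good being the
conclusion of the landed transfer lemma `PricedHcpWindowsBondShellTransfer.stub_bondShellTransfer`
(gap up to `(1.01 + θ) nn`, twelve points of norm `≤ (1.01 + θ) nn`).  If `P (T θ) > 0`, the transfer
clause with `R = 20/δ₁ + 1`, `ε = min (θ δ₁ / 400) (δ / 3)` (`δ₁ = min δ_LJ 1`, so that
`δ₁ ≤ nn_i ≤ 10/δ₁` at every site of every ground state with `N ≥ 2`) produces, eventually in `j`,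
`ρ φ_j` sites of `x (φ j)` whose `(R, ε)`-window is `ε`-close to some `count|S' ∈ T θ`; a site with a
charge-free `8 nn_i`-window is charge-free and SLP-matched (`SoftLayerPropagation` at `η = 1/100`), so
by `stub_bondShellTransfer` (with the second-shell gap `stub_barlowSecondShellGap`; `S'` is
`2ε`-separated because `2ε < δ`) `S'` would be θ-good.  Hence the matched sites have no charge-free
`8 nn_i`-window, contradicting `ChargeFreeWindows` along `φ` (`rsg_null_of_transfer`).  So a.e.
`count|S` is θ-good for every rational `θ ∈ (0, 1/100]`; letting `θ ↓ 0` gives the exact gap, and the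
twelve points at `θ = 1/100` (norm `≤ 1.02 nn < 1.07 nn`) fall within `1.01 nn` by the exact gap.
-/

namespace Summit.AtomisticToContinuum.Crystallization.Theorems.PricedHcpWindowsRootBondShellGood

open MeasureTheory Filter Topology
open Literature.MathematicalPhysics.StatisticalMechanics Literature.Geometry.DiscreteGeometry
open Literature.Probability.Process
open Summit.AtomisticToContinuum.Crystallization.Theorems.PricedHcpWindowsRootSlpGood
  (rsg_null_of_transfer rsg_close_of_count)

/-- Arithmetic of the transfer constants: with `ε = min (θ δ₁ / 400) (δ / 3)`, `R = 20/δ₁ + 1` and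
`δ₁ ≤ nn ≤ 10/δ₁`, the numeric side conditions of `stub_bondShellTransfer` hold and `2ε < δ`.
[folklore] -/
theorem rbg_constants {θ δ δ₁ nn : ℝ} (hθ : 0 < θ) (hδ : 0 < δ) (hδ₁ : 0 < δ₁)
    (h1 : δ₁ ≤ nn) (h2 : nn ≤ 10 / δ₁) :
    0 < min (θ * δ₁ / 400) (δ / 3) ∧ 400 * min (θ * δ₁ / 400) (δ / 3) ≤ θ * nn ∧
      2 * min (θ * δ₁ / 400) (δ / 3) < δ ∧ 2 * nn + 1 ≤ 20 / δ₁ + 1 := by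
  refine ⟨lt_min (div_pos (mul_pos hθ hδ₁) (by norm_num)) (div_pos hδ (by norm_num)), ?_, ?_, ?_⟩
  · calc 400 * min (θ * δ₁ / 400) (δ / 3) ≤ 400 * (θ * δ₁ / 400) :=
          mul_le_mul_of_nonneg_left (min_le_left _ _) (by norm_num)
      _ = θ * δ₁ := by ring
      _ ≤ θ * nn := mul_le_mul_of_nonneg_left h1 hθ.le
  · linarith [min_le_right (θ * δ₁ / 400) (δ / 3)]
  · have h4 : 2 * nn ≤ 20 / δ₁ :=
      calc 2 * nn ≤ 2 * (10 / δ₁) := by linarith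
        _ = 20 / δ₁ := by ring
    linarith

/-- Almost-sure avoidance of a countable family of null sets indexed by a rational parameter
`θ ∈ (0, 1/100]`. [folklore] -/
theorem rbg_ae_notMem_of_null {α : Type*} [MeasurableSpace α] {P : Measure α}
    {T : ℚ → Set α} (h : ∀ θ : ℚ, 0 < θ → θ ≤ 1 / 100 → P (T θ) = 0) :
    ∀ᵐ μ ∂P, ∀ θ : ℚ, 0 < θ → θ ≤ 1 / 100 → μ ∉ T θ := by
  refine ae_all_iff.2 fun θ => ?_
  by_cases hθ : 0 < θ
  · by_cases hθ1 : θ ≤ 1 / 100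
    · filter_upwards [measure_eq_zero_iff_ae_notMem.1 (h θ hθ hθ1)] with μ hμ
      exact fun _ _ => hμ
    · exact Eventually.of_forall fun μ _ h' => (hθ1 h').elim
  · exact Eventually.of_forall fun μ h' => (hθ h').elim

/-- From θ-goodness of `S` about `0` for all rational `θ ∈ (0, 1/100]` (no point of `S ∖ {0}` of
norm in `((1.01 + θ) nn, 1.07 nn)`, twelve points of norm `≤ (1.01 + θ) nn`) to bond-shell goodness
(the same at `θ = 0`, phrased through `dist 0 ·`). [folklore] -/
theorem rbg_good_of_rat {S : Set (EuclideanSpace ℝ (Fin 3))} {nn : ℝ}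
    (hG : ∀ θ : ℚ, 0 < θ → θ ≤ 1 / 100 →
      (∀ p ∈ S, p ≠ 0 → ‖p‖ < 107 / 100 * nn → ‖p‖ ≤ (101 / 100 + (θ : ℝ)) * nn) ∧
        ∃ T : Finset (EuclideanSpace ℝ (Fin 3)), (↑T : Set (EuclideanSpace ℝ (Fin 3))) ⊆
          {p : EuclideanSpace ℝ (Fin 3) | p ∈ S ∧ p ≠ 0 ∧ ‖p‖ ≤ (101 / 100 + (θ : ℝ)) * nn} ∧
          T.card = 12) :
    (∀ y ∈ S, y ≠ (0 : EuclideanSpace ℝ (Fin 3)) →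
        dist (0 : EuclideanSpace ℝ (Fin 3)) y < 107 / 100 * nn →
          dist (0 : EuclideanSpace ℝ (Fin 3)) y ≤ 101 / 100 * nn) ∧
      ∃ T : Finset (EuclideanSpace ℝ (Fin 3)), (↑T : Set (EuclideanSpace ℝ (Fin 3))) ⊆
        {y : EuclideanSpace ℝ (Fin 3) | y ∈ S ∧ y ≠ (0 : EuclideanSpace ℝ (Fin 3)) ∧
          dist (0 : EuclideanSpace ℝ (Fin 3)) y ≤ 101 / 100 * nn} ∧ T.card = 12 := by
  -- the exact gap, through norms: let `θ ↓ 0` along the rationals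
  have hgap : ∀ y ∈ S, y ≠ 0 → ‖y‖ < 107 / 100 * nn → ‖y‖ ≤ 101 / 100 * nn := by
    intro y hy hy0 hlt
    have hpos : 0 < nn := by
      by_contra h
      linarith [norm_nonneg y, not_lt.1 h]
    refine le_of_forall_pos_le_add fun ε hε => ?_
    obtain ⟨θ, hθ0, hθ1⟩ :=
      exists_rat_btwn (lt_min (by norm_num : (0 : ℝ) < 1 / 100) (div_pos hε hpos))
    have hθa : (θ : ℝ) < 1 / 100 := hθ1.trans_le (min_le_left _ _)
    have hθb : (θ : ℝ) < ε / nn := hθ1.trans_le (min_le_right _ _)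
    rw [lt_div_iff₀ hpos] at hθb
    have hθa' : θ ≤ 1 / 100 := by
      have h : ((θ : ℚ) : ℝ) ≤ ((1 / 100 : ℚ) : ℝ) := by
        rw [Rat.cast_div, Rat.cast_one, Rat.cast_ofNat]
        exact hθa.le
      exact Rat.cast_le.1 h
    have h1 := (hG θ (by exact_mod_cast hθ0) hθa').1 y hy hy0 hlt
    have h2 : (101 / 100 + (θ : ℝ)) * nn = 101 / 100 * nn + (θ : ℝ) * nn := by ring
    linarith
  have hd : ∀ y : EuclideanSpace ℝ (Fin 3), dist (0 : EuclideanSpace ℝ (Fin 3)) y = ‖y‖ :=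
    fun y => dist_zero_left y
  refine ⟨fun y hy hy0 hlt => ?_, ?_⟩
  · rw [hd] at hlt ⊢
    exact hgap y hy hy0 hlt
  · obtain ⟨-, T, hT, hcard⟩ := hG (1 / 100) (by norm_num) le_rfl
    refine ⟨T, fun p hp => ?_, hcard⟩
    obtain ⟨hpS, hp0, hple⟩ := hT hp
    refine ⟨hpS, hp0, ?_⟩
    rw [hd]
    by_cases h : ‖p‖ < 107 / 100 * nn
    · exact hgap p hpS hp0 h
    · push_cast at hple
      linarith [not_lt.1 h]

/-- **stub_rootBondShellGood** (ROOT BOND-SHELL GOODNESS OF THE LIMIT LAW).  Granted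
`SoftLayerPropagation` and the inlined `ChargeFreeWindows`, for the Benjamini–Schramm limit `P` of a
ground-state sequence (hard-core clause and density-transfer clause of item 9230), `P`-a.e.
configuration is `count|S` with `0 ∈ S` and the root `0` bond-shell-good: no point of `S ∖ {0}` at
distance in `(1.01 nn, 1.07 nn)` from `0` and twelve points of `S ∖ {0}` within `1.01 nn`
(`nn = infDist 0 (S ∖ {0})`).  By contraposition on the bad sets `T θ` (rational `θ ∈ (0, 1/100]`):
the transfer clause would give a positive density of sites whose window is `ε`-close to a non-θ-good
`δ`-separated `count|S'`, but such sites have no charge-free `8 nn_i`-window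
(`stub_bondShellTransfer` + `stub_barlowSecondShellGap` + `SoftLayerPropagation`), against
`ChargeFreeWindows` along `φ`; then `θ ↓ 0` (`rbg_good_of_rat`). [folklore] -/
theorem stub_rootBondShellGood : Summit.AtomisticToContinuum.Crystallization.Theses.PricedLinkCensus.SoftLayerPropagation → (∀ R : ℝ, 0 < R → ∀ x : (N : ℕ) → (Fin N → EuclideanSpace ℝ (Fin 3)), (∀ N, Literature.MathematicalPhysics.StatisticalMechanics.IsGroundState Literature.MathematicalPhysics.StatisticalMechanics.lennardJones (x N)) → Filter.Tendsto (fun N : ℕ => (Nat.card {i : Fin N // ¬ ∀ j : Fin N, dist (x N i) (x N j) ≤ R * Literature.Geometry.DiscreteGeometry.nearestDist (x N) i → Literature.Geometry.DiscreteGeometry.IsChargeFree (1 / 100 : ℝ) (x N) j} : ℝ) / N) Filter.atTop (nhds 0)) → ∀ x : (N : ℕ) → (Fin N → EuclideanSpace ℝ (Fin 3)), (∀ N, Literature.MathematicalPhysics.StatisticalMechanics.IsGroundState Literature.MathematicalPhysics.StatisticalMechanics.lennardJones (x N)) → ∀ φ : ℕ → ℕ, StrictMono φ → ∀ δ : ℝ,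 0 < δ → ∀ P : MeasureTheory.Measure (MeasureTheory.Measure (EuclideanSpace ℝ (Fin 3))), MeasureTheory.IsProbabilityMeasure P → (∀ᵐ μ ∂P, (∃ S : Set (EuclideanSpace ℝ (Fin 3)), (0 : EuclideanSpace ℝ (Fin 3)) ∈ S ∧ (∀ x ∈ S, ∀ y ∈ S, x ≠ y → δ ≤ dist x y) ∧ μ = (MeasureTheory.Measure.count : MeasureTheory.Measure (EuclideanSpace ℝ (Fin 3))).restrict S)) → (∀ T : Set (MeasureTheory.Measure (EuclideanSpace ℝ (Fin 3))), ∀ R ε : ℝ, 0 < ε → ∀ ρ : ℝ, ρ < (P T).toReal → ∀ᶠ j : ℕ in Filter.atTop, ρ * (φ j : ℝ) ≤ (Nat.card {i : Fin (φ j) // ∃ ν ∈ T, ((∀ p : EuclideanSpace ℝ (Fin 3), ν {p} ≠ 0 → ‖p‖ ≤ R → ∃ q ∈ (Set.range (fun k : Fin (φ j) => x (φ j) k - x (φ j) i)), dist q p ≤ ε) ∧ (∀ q ∈ (Set.range (fun k : Fin (φ j) => x (φ j) k - x (φ j) i)), ‖q‖ ≤ R → ∃ p : EuclideanSpace ℝ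 (Fin 3), ν {p} ≠ 0 ∧ dist q p ≤ ε))} : ℝ)) → (∀ᵐ μ ∂P, ∃ S : Set (EuclideanSpace ℝ (Fin 3)), μ = (MeasureTheory.Measure.count : MeasureTheory.Measure (EuclideanSpace ℝ (Fin 3))).restrict S ∧ (0 : EuclideanSpace ℝ (Fin 3)) ∈ S ∧ ((∀ y ∈ S, y ≠ (0 : EuclideanSpace ℝ (Fin 3)) → dist (0 : EuclideanSpace ℝ (Fin 3)) y < 107 / 100 * Metric.infDist (0 : EuclideanSpace ℝ (Fin 3)) (S \ {(0 : EuclideanSpace ℝ (Fin 3))}) → dist (0 : EuclideanSpace ℝ (Fin 3)) y ≤ 101 / 100 * Metric.infDist (0 : EuclideanSpace ℝ (Fin 3)) (S \ {(0 : EuclideanSpace ℝ (Fin 3))})) ∧ ∃ T : Finset (EuclideanSpace ℝ (Fin 3)), (↑T : Set (EuclideanSpace ℝ (Fin 3))) ⊆ {y : EuclideanSpace ℝ (Fin 3) | y ∈ S ∧ y ≠ (0 : EuclideanSpace ℝ (Fin 3)) ∧ dist (0 : EuclideanSpace ℝ (Fin 3)) y ≤ 101 / 100 * Metric.infDist (0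 : EuclideanSpace ℝ (Fin 3)) (S \ {(0 : EuclideanSpace ℝ (Fin 3))})} ∧ T.card = 12)) := by
  intro hSLP hCFW x hx φ hφ δ hδ P hP hcore htr
  haveI := hP
  -- (1) constants: `δ₁ = min δ_LJ 1`, `δ₁ ≤ nn_i ≤ 10 / δ₁`
  obtain ⟨δ₁, hδ₁pos, hδ₁1, hsep⟩ : ∃ δ₁ : ℝ, 0 < δ₁ ∧ δ₁ ≤ 1 ∧
      ∀ (N : ℕ) (i j : Fin N), i ≠ j → δ₁ ≤ dist (x N i) (x N j) := by
    obtain ⟨δ', hδ', hsep'⟩ := LennardJonesMinimalDistance_holds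
    exact ⟨min δ' 1, lt_min hδ' one_pos, min_le_right _ _,
      fun N i j hij => (min_le_left _ _).trans (hsep' N (x N) (hx N) i j hij)⟩
  have hnnle : ∀ (N : ℕ) (i : Fin N), nearestDist (x N) i ≤ 10 / δ₁ := fun N i =>
    nearestDist_le_of_isGroundState (hx N) hδ₁pos hδ₁1 (fun k l hkl => hsep N k l hkl) i
  have hnnge : ∀ (N : ℕ) (i : Fin N), 2 ≤ N → δ₁ ≤ nearestDist (x N) i := fun N i hN => by
    haveI := Fin.nontrivial_iff_two_le.2 hN
    exact le_nearestDist (exists_ne i) fun k hk => hsep N i k (Ne.symm hk)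
  -- (2) `ChargeFreeWindows` at radius `8` along `φ`
  have h3 : Tendsto (fun j => (Nat.card {i : Fin (φ j) // ¬ ∀ j' : Fin (φ j),
      dist (x (φ j) i) (x (φ j) j') ≤ 8 * nearestDist (x (φ j)) i →
        IsChargeFree (1 / 100 : ℝ) (x (φ j)) j'} : ℝ) / (φ j : ℝ)) atTop (𝓝 0) :=
    (hCFW 8 (by norm_num) x hx).comp hφ.tendsto_atTop
  -- (3) the bad sets `T θ` are `P`-null
  have hnull : ∀ θ : ℚ, 0 < θ → θ ≤ 1 / 100 →
      P {ν | ∃ S : Set (EuclideanSpace ℝ (Fin 3)),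
        ν = (Measure.count : Measure (EuclideanSpace ℝ (Fin 3))).restrict S ∧
        (0 : EuclideanSpace ℝ (Fin 3)) ∈ S ∧
        (∀ p ∈ S, ∀ p' ∈ S, p ≠ p' → δ ≤ dist p p') ∧
        ¬ ((∀ p ∈ S, p ≠ 0 →
              ‖p‖ < 107 / 100 * Metric.infDist (0 : EuclideanSpace ℝ (Fin 3)) (S \ {0}) →
              ‖p‖ ≤ (101 / 100 + (θ : ℝ)) * Metric.infDist (0 : EuclideanSpace ℝ (Fin 3)) (S \ {0})) ∧
            ∃ T : Finset (EuclideanSpace ℝ (Fin 3)), (↑T : Set (EuclideanSpace ℝ (Fin 3))) ⊆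
              {p : EuclideanSpace ℝ (Fin 3) | p ∈ S ∧ p ≠ 0 ∧
                ‖p‖ ≤ (101 / 100 + (θ : ℝ)) *
                  Metric.infDist (0 : EuclideanSpace ℝ (Fin 3)) (S \ {0})} ∧
              T.card = 12)} = 0 := by
    intro θ hθ hθ1
    have hθ' : (0 : ℝ) < θ := by exact_mod_cast hθ
    have hθ1' : (θ : ℝ) ≤ 1 / 100 := by
      have h : ((θ : ℚ) : ℝ) ≤ ((1 / 100 : ℚ) : ℝ) := Rat.cast_le.2 hθ1
      rwa [Rat.cast_div, Rat.cast_one, Rat.cast_ofNat] at h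
    have hε : 0 < min ((θ : ℝ) * δ₁ / 400) (δ / 3) :=
      lt_min (div_pos (mul_pos hθ' hδ₁pos) (by norm_num)) (div_pos hδ (by norm_num))
    refine rsg_null_of_transfer P _ hφ
      (fun ρ hρ => htr _ (20 / δ₁ + 1) (min ((θ : ℝ) * δ₁ / 400) (δ / 3)) hε ρ hρ) h3 ?_
    filter_upwards [eventually_ge_atTop 2] with j hj
    have hN : 2 ≤ φ j := hj.trans (hφ.id_le j)
    refine Nat.cast_le.2 (Nat.card_le_card_of_injective (fun a => ⟨a.1, fun hgood => ?_⟩)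
      fun a b hab => Subtype.ext (by simpa using congrArg Subtype.val hab))
    obtain ⟨ν, ⟨S', rfl, h0', hsep', hnm⟩, hC⟩ := a.2
    obtain ⟨s, g, hs, hA, hB⟩ := hSLP (1 / 100) (by norm_num) le_rfl (φ j) (x (φ j)) a.1 hgood
    have hge := hnnge (φ j) a.1 hN
    have hcf : IsChargeFree (1 / 100 : ℝ) (x (φ j)) a.1 :=
      hgood a.1 (by rw [dist_self]; linarith)
    obtain ⟨hε', h400, h2ε, hR⟩ := rbg_constants hθ' hδ hδ₁pos hge (hnnle (φ j) a.1)
    exact hnm (PricedHcpWindowsBondShellTransfer.stub_bondShellTransfer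
      PricedHcpWindowsSecondShellGap.stub_barlowSecondShellGap (φ j) (x (φ j)) a.1 S'
      (20 / δ₁ + 1) (min ((θ : ℝ) * δ₁ / 400) (δ / 3)) θ hε' hθ' hθ1' h400 hR ⟨s, hs, g, hA, hB⟩
      hcf h0' (fun p hp p' hp' hne => h2ε.trans_le (hsep' p hp p' hp' hne))
      (rsg_close_of_count (x (φ j)) a.1 S' (20 / δ₁ + 1) (min ((θ : ℝ) * δ₁ / 400) (δ / 3)) hC))
  -- (4) conclusion: a.e. `count|S` avoids every `T θ`, hence its root is bond-shell-good
  filter_upwards [hcore, rbg_ae_notMem_of_null hnull] with μ hμ hgood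
  obtain ⟨S, h0, hsepS, rfl⟩ := hμ
  refine ⟨S, rfl, h0, rbg_good_of_rat fun θ hθ hθ1 => ?_⟩
  by_contra hM
  exact hgood θ hθ hθ1 ⟨S, rfl, h0, hsepS, hM⟩

end Summit.AtomisticToContinuum.Crystallization.Theorems.PricedHcpWindowsRootBondShellGood
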